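import Summits.NavierStokesRegularity.FunctionalMining.TopEigDensityLocal
import HarnessLib

/-!
# FunctionalMining — the density identity (2) of F1 PART I, Proposition 3, POINTWISE at a simple point of
# the strain field, with no eigenpair input: `ρ_{e₁}(x) = F_q(x) − Δ(λ₁^q)(x)`

Search for candidate a priori estimates; no regularity claim. Cell `pub-nsfunc`, prove seat
(gen 23). Sequel of `TopEigDensityLocal.lean` (joint smoothness of `λ₁ = torusStrainTopEig v` near a
simple point, `Δλ₁(x) = eᵀS(Δv)(x)e + 2∑ₖ(channels)`). Here, for a simple point `x` in gap form at the
unit vector `e` with `λ = λ₁(x) > 0` (automatic for divergence-free `v`,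
`TopEig.lam_pos_of_gapForm_of_isDivFree`) and any real `q`:

* `TopEig.partialDeriv_partialDeriv_rpow_torusStrainTopEig_of_gapForm` —
  `∂ₖ∂ₖ(λ₁^q)(x) = q(q−1)λ^{q−2}(∂ₖλ₁(x))² + qλ^{q−1}∂ₖ∂ₖλ₁(x)`;
* `TopEig.laplacian_rpow_torusStrainTopEig_of_gapForm` —
  `Δ(λ₁^q)(x) = q(q−1)λ^{q−2}∑ₖ(∂ₖλ₁(x))² + qλ^{q−1}Δλ₁(x)` (genuine torus Laplacians);
* **`TopEig.densityIdentity_of_gapForm`** — F1 PART I (2) AT THE POINT: there are `N′ₖ` with channels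
  `N′ₖᵀS(∂ₖv)(x)e = λ|N′ₖ|² − N′ₖᵀS(x)N′ₖ ≥ 0` and
  `−qλ^{q−1}eᵀS(Δv)(x)e = [q(q−1)λ^{q−2}∑ₖ(eᵀS(∂ₖv)(x)e)² + 2qλ^{q−1}∑ₖN′ₖᵀS(∂ₖv)(x)e] − Δ(λ₁^q)(x)`,
  i.e. `ρ_{e₁} = F_q − Δ(λ₁^q)` with `F_q ≥ 0` termwise for `q ≥ 1`;
* `TopEig.laplacian_rpow_torusStrainTopEig_ge_of_gapForm` — hence `Δ(λ₁^q)(x) ≥ qλ^{q−1}eᵀS(Δv)(x)e`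
  (`ρ_{e₁}(x) ≥ −Δ(λ₁^q)(x)`) for `q ≥ 1`.

Static calculus of `v ↦ λ₁(sym ∇v)` on `T³`; nothing about Navier–Stokes dynamics. [ours]
-/

noncomputable section

open Filter Topology Matrix
open scoped ContDiff

namespace Summit.NavierStokesRegularity.FunctionalMining

open Literature.Analysis Literature.Analysis.FunctionSpaces Literature.Analysis.FunctionSpaces.Torus
  SharpClass.DirectorForm

namespace TopEig

variable {v : UnitAddTorus (Fin 3) → EuclideanSpace ℝ (Fin 3)}

/-! ## Powers `λ₁^q` and the density identity (2) at a simple point -/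

/-- **`∂ₖ∂ₖ(λ₁^q)(x) = q(q−1)λ^{q−2}(∂ₖλ₁(x))² + qλ^{q−1}∂ₖ∂ₖλ₁(x)`** at a simple point with `λ > 0`
(one-variable chain rule along the coordinate line, where `λ₁` is `C^∞`). [ours] -/
theorem partialDeriv_partialDeriv_rpow_torusStrainTopEig_of_gapForm (hv : Torus.IsSmooth v)
    {x : UnitAddTorus (Fin 3)} {e : Fin 3 → ℝ} {lam g : ℝ} (he1 : e ⬝ᵥ e = 1)
    (hSe : torusStrainMatrix v x *ᵥ e = lam • e) (hg : 0 < g)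
    (hgap : ∀ w, w ⬝ᵥ e = 0 → w ⬝ᵥ torusStrainMatrix v x *ᵥ w ≤ (lam - g) * (w ⬝ᵥ w))
    (hpos : 0 < lam) (q : ℝ) (k : Fin 3) :
    Torus.partialDeriv k (Torus.partialDeriv k (fun y => torusStrainTopEig v y ^ q)) x =
      q * (q - 1) * lam ^ (q - 2) * Torus.partialDeriv k (torusStrainTopEig v) x ^ 2 +
        q * lam ^ (q - 1) * Torus.partialDeriv k (Torus.partialDeriv k (torusStrainTopEig v)) x := by
  obtain ⟨-, -, -, -, hcd⟩ := exists_smooth_topEigenvector_chart_of_gapForm hv he1 hSe hg hgap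
  -- the line function `u ↦ λ₁(x + u eₖ)` is `C^∞` at `0`
  have hsm : ContDiff ℝ ∞ fun u : ℝ => u • EuclideanSpace.single k (1 : ℝ) :=
    contDiff_id.smul contDiff_const
  have hcd' : ContDiffAt ℝ ∞ (liftAt (torusStrainTopEig v) x)
      ((fun u : ℝ => u • EuclideanSpace.single k (1 : ℝ)) 0) := by
    rw [show (fun u : ℝ => u • EuclideanSpace.single k (1 : ℝ)) 0 = 0 by simp]
    exact hcd
  have hl0 : ContDiffAt ℝ ∞
      (liftAt (torusStrainTopEig v) x ∘ fun u : ℝ => u • EuclideanSpace.single k (1 : ℝ)) 0 :=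
    hcd'.comp 0 hsm.contDiffAt
  have hl : ContDiffAt ℝ ∞
      (fun u : ℝ => torusStrainTopEig v (x + proj (u • EuclideanSpace.single k (1 : ℝ)))) 0 := hl0
  have hl1 : ContDiffAt ℝ 1
      (fun u : ℝ => torusStrainTopEig v (x + proj (u • EuclideanSpace.single k (1 : ℝ)))) 0 :=
    hl.of_le (by simp)
  have hdiff : ∀ᶠ u in 𝓝 (0 : ℝ), DifferentiableAt ℝ
      (fun u : ℝ => torusStrainTopEig v (x + proj (u • EuclideanSpace.single k (1 : ℝ)))) u := by
    filter_upwards [hl1.eventually (by simp)] with u hu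
    exact hu.differentiableAt (by simp)
  -- its first two derivatives at `0` are `∂ₖλ₁(x)`, `∂ₖ∂ₖλ₁(x)`
  have ha : HasDerivAt (fun u : ℝ => torusStrainTopEig v (x + proj (u • EuclideanSpace.single k (1 : ℝ))))
      (Torus.partialDeriv k (torusStrainTopEig v) x) 0 :=
    (hl.differentiableAt (by simp)).hasDerivAt
  have hb : HasDerivAt (deriv fun u : ℝ => torusStrainTopEig v (x + proj (u • EuclideanSpace.single k (1 : ℝ))))
      (Torus.partialDeriv k (Torus.partialDeriv k (torusStrainTopEig v)) x) 0 := by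
    rw [partialDeriv_partialDeriv_eq_deriv_deriv]
    exact (differentiableAt_deriv_of_contDiffAt (hl.of_le (WithTop.coe_le_coe.2 le_top))).hasDerivAt
  have hx : torusStrainTopEig v x = lam := torusStrainTopEig_eq_of_gapForm he1 hSe hg hgap
  have hpos' : 0 < (fun u : ℝ => torusStrainTopEig v (x + proj (u • EuclideanSpace.single k (1 : ℝ)))) 0 := by
    show 0 < torusStrainTopEig v (x + proj ((0 : ℝ) • EuclideanSpace.single k (1 : ℝ)))
    rw [coordLine_zero, hx]
    exact hpos
  have H := hasDerivAt_deriv_rpow q hdiff ha hb hpos'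
  rw [partialDeriv_partialDeriv_eq_deriv_deriv, H.deriv]
  simp only [coordLine_zero, hx]

/-- **`Δ(λ₁^q)(x) = q(q−1)λ^{q−2}∑ₖ(∂ₖλ₁(x))² + qλ^{q−1}Δλ₁(x)`** at a simple point with `λ > 0`.
[ours] -/
theorem laplacian_rpow_torusStrainTopEig_of_gapForm (hv : Torus.IsSmooth v)
    {x : UnitAddTorus (Fin 3)} {e : Fin 3 → ℝ} {lam g : ℝ} (he1 : e ⬝ᵥ e = 1)
    (hSe : torusStrainMatrix v x *ᵥ e = lam • e) (hg : 0 < g)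
    (hgap : ∀ w, w ⬝ᵥ e = 0 → w ⬝ᵥ torusStrainMatrix v x *ᵥ w ≤ (lam - g) * (w ⬝ᵥ w))
    (hpos : 0 < lam) (q : ℝ) :
    Torus.laplacian (fun y => torusStrainTopEig v y ^ q) x =
      q * (q - 1) * lam ^ (q - 2) * ∑ k, Torus.partialDeriv k (torusStrainTopEig v) x ^ 2 +
        q * lam ^ (q - 1) * Torus.laplacian (torusStrainTopEig v) x := by
  obtain ⟨-, -, -, -, hcd⟩ := exists_smooth_topEigenvector_chart_of_gapForm hv he1 hSe hg hgap
  have hx : torusStrainTopEig v x = lam := torusStrainTopEig_eq_of_gapForm he1 hSe hg hgap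
  have hne : liftAt (torusStrainTopEig v) x 0 ≠ 0 := by
    rw [liftAt_apply_zero, hx]
    exact hpos.ne'
  have hq : ContDiffAt ℝ 2 (liftAt (fun y => torusStrainTopEig v y ^ q) x) 0 :=
    (hcd.rpow_const_of_ne (p := q) hne).of_le (WithTop.coe_le_coe.2 le_top)
  rw [laplacian_eq_sum_partialDeriv_partialDeriv_of_contDiffAt hq,
    laplacian_torusStrainTopEig_eq_sum_of_gapForm hv he1 hSe hg hgap]
  simp_rw [partialDeriv_partialDeriv_rpow_torusStrainTopEig_of_gapForm hv he1 hSe hg hgap hpos q]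
  rw [Finset.sum_add_distrib, ← Finset.mul_sum, ← Finset.mul_sum]

/-- **THE DENSITY IDENTITY (F1 PART I, PROPOSITION 3 (2)) AT A SIMPLE POINT, NO EIGENPAIR INPUT.**
For a smooth field `v` on `T³`, a point `x` where `λ₁(S(v))` is simple in gap form at `e` with
`λ = λ₁(x) > 0`, and any real `q`: there are `N′ₖ ∈ ℝ³` with channels
`N′ₖᵀS(∂ₖv)(x)e = λ|N′ₖ|² − N′ₖᵀS(x)N′ₖ ≥ 0` such that the density seen by `e₁`,
`ρ_{e₁}(x) = −qλ^{q−1}eᵀS(Δv)(x)e`, equals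
`[q(q−1)λ^{q−2}∑ₖ(eᵀS(∂ₖv)(x)e)² + 2qλ^{q−1}∑ₖN′ₖᵀS(∂ₖv)(x)e] − Δ(λ₁^q)(x)` — a non-negative channel
sum (`q ≥ 1`) minus the torus Laplacian of `λ₁^q` at `x`. [ours; F1 PART I Prop. 3 (2)] -/
theorem densityIdentity_of_gapForm (hv : Torus.IsSmooth v)
    {x : UnitAddTorus (Fin 3)} {e : Fin 3 → ℝ} {lam g : ℝ} (he1 : e ⬝ᵥ e = 1)
    (hSe : torusStrainMatrix v x *ᵥ e = lam • e) (hg : 0 < g)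
    (hgap : ∀ w, w ⬝ᵥ e = 0 → w ⬝ᵥ torusStrainMatrix v x *ᵥ w ≤ (lam - g) * (w ⬝ᵥ w))
    (hpos : 0 < lam) (q : ℝ) :
    ∃ N' : Fin 3 → Fin 3 → ℝ,
      (∀ k, N' k ⬝ᵥ (torusStrainMatrix (Torus.partialDeriv k v) x *ᵥ e) =
          lam * (N' k ⬝ᵥ N' k) - N' k ⬝ᵥ (torusStrainMatrix v x *ᵥ N' k) ∧
        0 ≤ N' k ⬝ᵥ (torusStrainMatrix (Torus.partialDeriv k v) x *ᵥ e)) ∧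
      -(q * lam ^ (q - 1) * (e ⬝ᵥ (torusStrainMatrix (Torus.laplacian v) x *ᵥ e))) =
        (q * (q - 1) * lam ^ (q - 2) * ∑ k, (e ⬝ᵥ (torusStrainMatrix (Torus.partialDeriv k v) x *ᵥ e)) ^ 2 +
            2 * q * lam ^ (q - 1) * ∑ k, N' k ⬝ᵥ (torusStrainMatrix (Torus.partialDeriv k v) x *ᵥ e)) -
          Torus.laplacian (fun y => torusStrainTopEig v y ^ q) x := by
  obtain ⟨N', hlap, hk⟩ := laplacian_torusStrainTopEig_eq_of_gapForm hv he1 hSe hg hgap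
  refine ⟨N', fun k => ⟨(hk k).2.2.1, (hk k).2.2.2⟩, ?_⟩
  rw [laplacian_rpow_torusStrainTopEig_of_gapForm hv he1 hSe hg hgap hpos q, hlap]
  have h1 : ∑ k, Torus.partialDeriv k (torusStrainTopEig v) x ^ 2 =
      ∑ k, (e ⬝ᵥ (torusStrainMatrix (Torus.partialDeriv k v) x *ᵥ e)) ^ 2 :=
    Finset.sum_congr rfl fun k _ => by rw [(hk k).1]
  rw [h1]
  ring

/-- **`Δ(λ₁^q)(x) ≥ qλ^{q−1} eᵀS(Δv)(x)e` at a simple point with `λ > 0`, `q ≥ 1`** — i.e.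
`ρ_{e₁}(x) ≥ −Δ(λ₁^q)(x)`: the density seen by `e₁` is bounded below by an exact Laplacian on the
simple set. [ours; F1 PART I Prop. 3 (2)] -/
theorem laplacian_rpow_torusStrainTopEig_ge_of_gapForm (hv : Torus.IsSmooth v)
    {x : UnitAddTorus (Fin 3)} {e : Fin 3 → ℝ} {lam g : ℝ} (he1 : e ⬝ᵥ e = 1)
    (hSe : torusStrainMatrix v x *ᵥ e = lam • e) (hg : 0 < g)
    (hgap : ∀ w, w ⬝ᵥ e = 0 → w ⬝ᵥ torusStrainMatrix v x *ᵥ w ≤ (lam - g) * (w ⬝ᵥ w))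
    (hpos : 0 < lam) {q : ℝ} (hq : 1 ≤ q) :
    q * lam ^ (q - 1) * (e ⬝ᵥ (torusStrainMatrix (Torus.laplacian v) x *ᵥ e)) ≤
      Torus.laplacian (fun y => torusStrainTopEig v y ^ q) x := by
  rw [laplacian_rpow_torusStrainTopEig_of_gapForm hv he1 hSe hg hgap hpos q]
  have hge := laplacian_torusStrainTopEig_ge_of_gapForm hv he1 hSe hg hgap
  have h1 : 0 ≤ q * (q - 1) * lam ^ (q - 2) * ∑ k, Torus.partialDeriv k (torusStrainTopEig v) x ^ 2 := by
    have hq0 : 0 ≤ q := by linarith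
    have hq1 : 0 ≤ q - 1 := by linarith
    have hp : 0 ≤ lam ^ (q - 2) := Real.rpow_nonneg hpos.le _
    have hs : 0 ≤ ∑ k, Torus.partialDeriv k (torusStrainTopEig v) x ^ 2 :=
      Finset.sum_nonneg fun k _ => sq_nonneg _
    positivity
  have h2 : 0 ≤ q * lam ^ (q - 1) := by
    have hq0 : 0 ≤ q := by linarith
    have hp : 0 ≤ lam ^ (q - 1) := Real.rpow_nonneg hpos.le _
    positivity
  nlinarith [mul_le_mul_of_nonneg_left hge h2]

end TopEig

end Summit.NavierStokesRegularity.FunctionalMining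

end
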